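import Literature.MathematicalPhysics.QuantumFieldTheory.Balaban1983to89.B15ComplexSpaces
import Literature.MathematicalPhysics.QuantumFieldTheory.Balaban1983to89.B14Radii

/-!
# `Balaban1983to89.B15.Membership195` — B15 p. 195 ll. 17–23: the deferred membership claim *"U₀ belongs … to the
analyticity domains … Ũ^{(n)c}_k(X, α̃₀, α̃₁)"* — the cell's repair census (GAPS G-B15-03 ∕ G-adv3-18) as kernel
arithmetic on the line of the definition that governs `Ω_k ∩ X` — (1.68)(iii) at the top rung `m = k` (Parts A–E) — and,
neutrally as to the printed domain of the estimate (1.80), on the lines below it (Part F, v1.2; v1.3 = docstring fold of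
the cross-read C-adv3-87)

CITATION HEADER (lean-in-tree rule 2026-08-18).  T. Bałaban, *Large field renormalization. I. The basic step of the 𝐑
operation*, Comm. Math. Phys. **122**, 175–202 (1989) [Balaban1989LargeFieldI] (cell paper B15 = primary P15; PDF held
`paper:balaban1989-cmp122-large-field-i`, journal page = PDF page + 174); the quotations below were read off the page
renders p016, p017, p018, p019, p020, p021, p022, p023 (journal pp. 190–197) of the cell folder `b2b-balaban-ref1/
pages/1989-cmp122-large-field-I/`, not the OCR (v1 listed six of them; p017 = p. 191 and p018 = p. 192 were re-read as
images for v1.1, cross-read D-2; p003 = p. 177 and p016 = p. 190 were read for v1.2, (r1′) below; p003 re-read for v1.3,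
cross-read C-adv3-87 D1 ∕ D2).  The two LOCATED SHAPES of Parts C and D quote T. Bałaban, *Renormalization
group approach to lattice gauge field theories. I*, Comm. Math. Phys. **109**, 249–301 (1987) [Balaban1987RG1] (= [I],
cell paper B12), p. 263 (1.17), read off the render `…/1987-cmp109-rg-I-small-field/…-p015-x2.png`, and T. Bałaban,
*Spaces of regular gauge field configurations on a lattice and gauge fixing conditions*, Comm. Math. Phys. **99**, 75–102
(1985) [Balaban1985RegularSpaces] (= B15's *"[14]"*, cell paper B8), p. 99 Proposition 6, read off the render
`…/1985-cmp99-regular-spaces-gauge-fixing/…-p025-x2.png` (and, for the located remark on `11d²` in (r3) below, p. 87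
(1.65), render `…-p013-x2.png`, re-read for v1.1).  Part E uses T. Bałaban, *Convergent renormalization
expansions for lattice gauge theories*, Comm. Math. Phys. **119**, 243–285 (1988) [Balaban1988Convergent] (= [III], cell
paper B14), (2.4) p. 255 and (2.28) p. 259, ONLY through the tree module `…Balaban1983to89.B14Radii` (unit pv02), imported
and used by name (`B14Radii.fits_of_exponents`, `B14Radii.exponent_necessary`); the located GEOMETRY of (r1′) quotes
[III] p. 268 (3.16) and p. 269 (3.20), read off the renders `…/1988-cmp119-convergent-renormalization/…-p026-x2.png`,
`…-p027-x2.png` (journal page = PDF page + 242) for v1.2 (p027 re-read for v1.3: the two sentences before (3.20) and the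
modification sentence after it, cross-read C-adv3-87 P1), as docstring data only; the sentence of [Balaban1989LargeFieldII]
(= [V], cell paper B16) p. 361 *"Using the estimate (1.80) [IV] and Theorem 1 [15]"* is quoted from the docstring of the
tree leaf `B15.Ineq180` (unit r2) and was not re-read here.  The papers are manuscripts UNDER ADJUDICATION by the audit
cell `pub-balaban`; NOTHING printed in them is asserted in this file: the printed displays enter as the schematic `Prop`
leaves of the sibling modules `…B15` (`Ineq180`), `…B15.BasicStep` (`lfFactor`) and `…B15.ComplexSpaces` (`Clause168`,
`cConst`, `Cube165`) — imported, not modified — and as the two hypothesis SHAPES `Shape117`, `Shape1136` defined below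
(docstring = quotation + page); every `theorem` is elementary real arithmetic over them, proved without `sorry` and
without new axioms.  NEW leaf of unit `b2b-balaban-b01` (fallback seat, PHASE-2 row P15), generation 26 (v1, v1.1),
extended APPEND-ONLY in generation 27 (v1.2, Part F); it modifies no existing declaration.  Census: GAPS.md C-b01g26-1,
C-b01g27-1; DIVERGENCE.md D-b01g26.1.

WHAT IS PRINTED (verbatim).
* B15 p. 195 [PDF 21]: *"Extend the function V_Λ on the whole domain Z putting V_Λ = V_k on Z∩Λ^c, and define
  U₀ = U_{k,Z}(V_Λ). (1.79) This is a fundamental background field for the constructions of this and the next sections.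
  In particular we expand the action A″_k in (1.76) around this configuration on Λ∩Z^c_h; therefore it is important to
  understand its regularity properties. To simplify the description we take into account the characteristic function
  χ_{k,Λ}. The restrictions introduced by this function, and the method of construction of the function V_Λ, imply the
  estimate |U₀(∂p) − 1| < 2ε_kη² + O(1)B₃B₅M⁵exp(−δ dist(p, Λ))ε_kη² (1.80) for p ∈ Ω_k. We will discuss it together
  with the proof of Proposition 1, because then it will be immediate, but it follows also quite generally from the
  definition (1.79) and the bound (1.78). From the estimate (1.80) we can see easily that the configuration U₀ belongs
  to the integration domain determined by the characteristic function χ″_k in (1.76), and to the analyticity domains of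
  terms in the effective action A″_k. In fact, it is the reason why we have done the preliminary integrations, and why
  we have introduced the function χ″_k, and the spaces Ũ^{(n)c}_k(X, α̃₀, α̃₁). We do not show the above statement now,
  because we will need a stronger statement in the future."*  (1.80) is the tree leaf `B15.Ineq180` (its `O(1)` an
  explicit parameter `C`); Proposition 1 and (1.78) *"|V_Λ(∂p′) − 1| < B₅M⁵ε for p′ ∈ Λ"* (p. 194) are `B15.Prop1Printed`.
* B15 p. 193 [19]: (1.75) *"χ_{k,Λ} = χ({inf_{V_k↾Λ} sup_{p∈Ω_k^c} |U_{k,Z}(∂p) − 1| < 2ε_kη²})"*; *"recall that the functions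
  χ_k(Ω^{~4}_k), χ″_k restrict the field variables V_k on Ω″_k, e.g., |∂V_k − 1| < 2L₀^{2N₀}ε_k < 2L(L+1)N₀^{−1}R_kε_k"*;
  *"On the other hand, for any extension we have |∂U_{k,Z} − 1| ≧ 2ε_kη²"* (in the region of `1 − χ_{k,Λ}`).
* B15 p. 191 [17], (1.68)(iii) and (1.69) — transcribed verbatim in the docstrings of `ComplexSpaces.Clause168`,
  `ComplexSpaces.cConst`, `ComplexSpaces.Cube165`; the parts used here: the seven quantities *"|∂𝕌 − 1|,
  |∂U_{p,X}(M˙(𝕌)) − 1|, |𝕁|, |𝕁_{p,X}(M˙(𝕌))|, |∂U − 1|, |A′|, |∇^η_U A′| < (1 − β Σ_{i=h+1}^{j} 2^{−|m−i|} −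
  β Σ_{q=m+1}^{k} 2^{−(q−m)})·c[α_{0,m}η²(L^mη)^{−2}, α_{0,m}L^{−2p}(L^mL^{−p})^{−2}, α_{0,m}(L^mη)^{−3},
  α_{0,m}L^{m−min{p,m}}(L^mL^{−p})^{−3}, α_{0,m}η²(L^mη)^{−2}, α_{1,m}(L^mη)^{−1}, α_{1,m}(L^mη)^{−2}] on (Ω_m∖Ω_{m+1})∩X
  for m = j+1,…,k−1, and on Ω_k∩X for m = k, where c = 1 for m < k, and c = 3 for m = k"*; (1.69) *"L^mη|A|,
  (L^mη)²|∇^ηA| < BCMα_{0,m} for … □ ⊂ Ω_k if m = k, □ is of the size CML^mη. The constant C above is a positive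
  integer … we can assume that C ≦ 2. The constant B is a fixed absolute constant, for example we can take the constant
  B = B₃ from Theorem 1 [16]"*; and p. 191 *"if β ≦ 1/4 and L₀² ≦ (1/3)L"*.
* B15 p. 197 [23] (the background field INSIDE `Λ`, for comparison of scales only): (1.83) *"|V_Λ(b) − 1| < O(1)B₅M⁶ε_k
  for b ⊂ Λ^{(k)}"*; *"Consider the configuration U₀ inside the domain Λ. We take it in the axial gauge in k-blocks,
  hence |M^j(U₀) − Q^{s*}_{k−j}V_Λ| < 11d²O(1)B₃B₅M⁵ε_k inside Λ, by the estimate (1.80), and (1.65) [14]. This and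
  (1.83) imply |M^j(U₀) − 1| < O(1)B₃B₅M⁶ε_k inside Λ. (1.84)"*; (1.87) *"|𝔸₀|, |∇^η𝔸₀|, |∂^{η*}∂^η𝔸₀| < O(1)B₃²B₅M⁶ε_k
  on Z″_k"* (tree leaves `BasicStep.Ineq183/184/187`).
* [I] p. 263 [PDF 15]: *"Now consider the functions U_n(M˙(𝐔)). We have M˙(𝐔) = Ū^p on Λ_p, |∂Ū^p − 1| < 2α₀′(L^pξ)².
  From Proposition 9 [15] we obtain |∂U_n(M˙(𝐔)) − 1| < B₃2α₀′L^{−2n}(Lⁿξ)² = 2B₃α₀′ξ², |J_n(M˙(𝐔))| < B₃2α₀′(Lⁿξ)² on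
  X̃^{−2}. (1.17) It is obvious that for α₀′ sufficiently small the above estimates imply the condition (iv), thus the
  configuration (𝐔, 𝐉) belongs to the space U^c_j(X, α₀, α₁). … and such that 𝐉 = D^{ξ*}_𝐔ξ^{−2}π Im ∂𝐔 satisfies the
  bound |𝐉| < α₀′ … In particular the minimal configurations U_j satisfying the bound |∂U_j − 1| < ε₀ξ² with ε₀
  sufficiently small, satisfy the above conditions."* ([I]'s *"[15]"* = T. Bałaban, CMP **102**, 277–309, cell paper B11;
  [V] p. 361 names the same source: *"Using the estimate (1.80) [IV] and Theorem 1 [15]"*.  The domain of (1.17): [I]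
  p. 262 [PDF 14] *"The domain X̃^{−2} is obtained from X by taking away two layers of cubes from π_j, which are closest
  to the boundary of X."* — v1 ∕ v1.1 mis-transcribed its superscript as `~2`; corrected in v1.2, cross-read GAPS
  C-adv3-80 D2, render `…-p014-x2.png`.)
* B8 p. 99 [PDF 25]: (1.130) *"… < 11d²L²α₀ + 5dL²Mα₀ < 6dL²Mα₀"*; **Proposition 6.** *"Let U₀, U′₀, □, □̃ be as
  described above, and let 7dL²Mα₀ ≦ c₁. There exists a gauge transformation u defined on □̃ and such, that
  U₀^{u⁻¹} = U₁ = e^{iηA} on □̃, (1.135) L^jη|A|, (L^jη)²|∇^ηA|, (L^jη)³|∂^{η*}∂^ηA|, (L^jη)³|Δ^ηA| < 7dL²B₁Mα₀ on □_j,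
  (1.136)"* (tree leaf `B8.Prop6Printed`, unit r1).

THE READING TYPED HERE (schematic reals; DIVERGENCE D-b01g26.1 — regions, lattices and fields are docstring data, as in
`…B15.ComplexSpaces`, D-b01g25.1).
(r1) WHICH LINE (definition side; independent of the reading of (1.80)'s domain, (r1′)).  Under the nesting of the
  printed regions read in `…B15.ComplexSpaces` (its NOT CERTIFIED (b): `Ω″_1 ⊃ ⋯ ⊃ Ω″_j ⊃ Ω_{k₀+1} ⊃ ⋯ ⊃ Ω_k`) the
  points of `Ω_k ∩ X` are governed by exactly ONE line of the definition of `Ũ^{(n)c}_k(X, α̃₀, α̃₁)`: (1.68)(iii) at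
  `m = k` (p. 191 *"and on Ω_k∩X for m = k"*) — factor `lfFactor β h j k k`, constant `c = 3` (`cConst_top`), NO power
  of `L₀` — together with the unweighted cube condition (1.69) on cubes of size `CM`; the lines (1.64)(i), (1.66)(ii)
  and (1.68)(iii) for `m < k` live on `(Ω″_m∖Ω″_{m+1})∩X`, `(Ω_m∖Ω_{m+1})∩X`, i.e. OUTSIDE `Ω_k` (v1 ∕ v1.1 added here
  *"where (1.80) says nothing"* — true under READING L of (r1′) only; withdrawn as a reading-dependent gloss, GAPS
  C-b02g24-1 (5c)).  Part A computes the top-rung factor exactly: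
  `lfFactor β h j k k = 1 − 2β·2^{−(k−j)} + 2β·2^{−(k−h)}` (`lfFactor_top`), hence `∈ [1 − β, 1]` for `j < k`
  (`lfFactor_top_ge`, `ComplexSpaces.lfFactor_le_one`) and `3·lfFactor ≥ 9/4` under the printed `β ≤ 1/4`
  (`three_lfFactor_top_ge`).  The units of the first, second and fifth entries coincide at `m = k`: `η²(L^kη)^{−2} =
  L^{−2p}(L^kL^{−p})^{−2} = η²`, `η = L^{−k}` (`unit_entry2_top`), so the rows below are written in the single unit
  `α_{0,k}η²`.
(r1′) WHERE (1.80) SPEAKS (v1.2) — the cell's two readings, NOT adjudicated in this file.  (1.80) is printed *"for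
  p ∈ Ω_k"* (renders `…-p021-x2.png`, `…-p021-x4.png`: no superscript, no prime; GAPS G-adv7-25, unit adv7).  LOCATED
  GEOMETRY (v1.3 wording, cross-read C-adv3-87 D1 ∕ D2 ∕ P1): `Z` is the UNION of the admissible components of the large
  field region `Λ_k^c` of [III] and `X` is one of them — B15 p. 177 [PDF 3]: *"It is a union of connected components.  We
  consider components of almost the minimal possible size."*, conditions (i), (ii), *"Let us denote the union of the
  above class of components by Z."*, and (1.1) *"where Z = ⋃_{i=1}^{m} X_i is the decomposition into disjoint
  components"* (v1.2 wrote *"`Z` is a component"* and put a paraphrase inside quotation marks; the located geometry below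
  holds componentwise, so nothing downstream changes).  [III] p. 269 [PDF 27] reads, before (3.20), *"The domain R′_{k+1}
  is defined, as usual, as a union of the LMR_{k+1}-cubes intersecting R_{k+1}.  We surround the domain (Ω^c_{k+1})^~ ∪
  R′_{k+1} by a layer of LMR_{k+1}-cubes, and we denote the complement of the so-obtained domain by Λ_{k+1}"*, then (3.20)
  *"Λ_{k+1} = ((Ω^c_{k+1})^{~2} ∪ R′_{k+1})^c = Ω^{~−2}_{k+1} ∩ (R′^~_{k+1})^c"*, with (3.16) p. 268 placing the subdomains
  `R_{k+1} ⊂ Ω^{~−1}_{k+1}` where `sup|A_k(b)| ≥ δ_k` (the sup over the bonds of the enlarged cube), and after (3.20) the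
  MODIFICATION *"In fact we modify the domain Λ_{k+1} in the same way as in Sect. 1; we consider components of Λ^c_{k+1},
  and if a component is contained in a cube of the size 100LMR_{k+1}, then we replace it by the smallest rectangular
  parallelepiped containing it"* (B15 p. 177: *"for such a component all the regions connected with the last N steps are
  rectangular parallelepipeds"*) — precisely the components of condition (i) are the hull-replaced ones.  Hence, for a
  component `X` of `Z`, `X ∩ Ω_k` lies in the parallelepiped hull of the (at most two) outer layers of `LMR_k`-cubes of
  the `~`-operation inside `Ω_k` — the COLLAR — together with the `R′^~_k`-pockets, and may strictly contain collar ∪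
  pockets (the hull fills the space between them); `X ∩ Ω_k^c ⊃ Λ ⊃ Z″_k` is the core ((1.73) p. 192; G-adv7-25 (a)).  For
  (r1) none of this matters: whatever its shape, `Ω_k ∩ X` is the top rung.
  READING L (literal; v1's): (1.80) bounds `U₀` exactly on the top rung `Z ∩ Ω_k ∩ X` of (r1) and nowhere below it —
  then Parts B–E consume (1.80) itself, and no located printed sentence of [IV] §1 or [V] §1 uses that instance (GAPS
  C-b02g24-1 (2), unit b02: all NINE located uses of (1.80) lie in `Z ∩ Ω_k^c`; the `j = k` domain of [IV] p. 199,
  *"Ω^c_k∖Z″_k"*, excludes `Ω_k` by name).  READING C (the cell's consumer reading: G-adv7-25 (c) *"p ∈ Ω_k^c ∩ Z"* —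
  *"a dropped superscript, the (1.75) domain"* — which fits all nine loci, C-b02g24-1 (5b)): (1.80) bounds `U₀` on every
  line BELOW the top rung that meets `Z` — the rungs `m < k` of (1.68)(iii) and the `L₀`-weighted lines (Part F) — and
  says NOTHING on the top rung, where no printed display bounds `U₀` at all ((1.75): a sup over `p ∈ Ω_k^c`; (1.78),
  (1.83), (1.84), (1.87): on `Λ` ∕ `Z″_k`); candidate top-rung sources located by the cell, none certified and none
  asserted here: the shape (H*) *"|U₀(∂p) − 1| < 2B₃B₅M⁵ε_kη² for every p ⊂ Z"* PROPOSED by unit adv7 (GAPS G-adv7-24,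
  from Proposition 1 (1.78) and Theorem 1 [15] at one scale), or a `χ_k(Ω_k^{~4})`-type restriction of `V_k` on `Ω″_k`
  (p. 193 ll. 19–21 quoted above) transported through Theorem 1 [15] (C-b02g24-1, consistency flag; G-adv7-25 (a): an
  allowance larger than `2ε_kη²` by the factor `L₀^{2N₀}`).  THIS FILE TAKES NO SIDE: its rows consume only a datum of
  the SHAPE of (1.80) at the point in question, `d < (2 + C·B₃B₅M⁵e^{−δ·dist})ε_kη²` resp. its sup
  `d < (2 + C·B₃B₅M⁵)ε_kη²` (`bound180_uniform`; shape-only rows `clause168_top_of_bound`, `clause168_rung_of_bound`,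
  `clause164_of_bound` of Part F) — under READING L that datum is (1.80) on the top rung (Parts B–E, names unchanged);
  under READING C it is (1.80) on the lines below the top rung (Part F: `clause168_rung_of_180`, `clause164i_of_180`,
  `clause166_of_180`) and, on the top rung, whatever supplies the shape there ((H*)'s constant obeys `2B₃B₅M⁵ ≤
  2 + C·B₃B₅M⁵` for `C ≥ 2`: `hstarShape_within_uniform`, `clause168_top_of_hstar`).  Whether the printed *"Ω_k"* is a
  misprint is a print-level question owned by GAPS G-adv7-25 and is not decided by anything proved here.
(r2) REAL SLICE.  `U₀` is `G`-valued: in `𝕌 = U′U` one takes `U = U₀`, `U′ = 1`, `A′ = 0`, so the fifth entry equals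
  the first and the sixth and seventh vanish (a vanishing entry meets its clause as soon as the radius is positive,
  `clause168_of_zero`).  The CURRENT entries `|𝕁|`, `|𝕁_{p,X}(M˙(𝕌))|` are NOT set to zero here: on the real slice
  `𝕁` is tied to `𝕌` by [I] (1.8)–(1.9) (`…B15.ComplexSpaces` Part D keeps the 𝕁-rule a parameter), and [I] p. 263
  bounds the current of a local minimizer by the second line of (1.17) with the SAME constant `B₃` — class R4 below,
  located only (the cell's census G-adv3-18 (1) takes `𝕁 = J_{p,X} = 0` for real `U₀`; under either reading no
  constant beyond `B₃` enters).
(r3) DATA.  The plaquette entry is fed by a datum of the SHAPE of (1.80) — (1.80) itself under READING L of (r1′)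
  (Part B keeps v1's `clause168_top_of_180` for that case; v1.2 adds the source-free `clause168_top_of_bound` and, for
  the (H*)-shape, `clause168_top_of_hstar`; v1 ∕ v1.1 wrote *"fed by (1.80) directly"*, GAPS C-b02g24-1 (5c)).  The local minimizers `U_{p,X}(M˙(U₀))` are built on
  the AVERAGES of `U₀`; the located shape (Part C, `Shape117`) is the first line of (1.17) [I]: deviation `< 2B₃·(data)`,
  the printed `2` being the averaging factor (*"|∂Ū^p − 1| < 2α₀′(L^pξ)²"*); a slot `K ≥ 1` is kept for the
  geometry-dependent averaging constant (B15 p. 197 ll. 8–9 carry `11d²` *"by the estimate (1.80), and (1.65) [14]"*;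
  (1.65) [14] is B8 p. 87 [PDF 13] *"|(U′U₀)‾^j − Ū₀^j| = |Ũ′^j − 1| < 11d²α₀ + α₁ on Ω_j^{(j)}"*, obtained there from
  *"… < 8d²α₀(1 − L^{−2})^{−1} + α₁ < 11d²α₀ + α₁"* — an averaged-configuration comparison; v1's identification of it
  with (1.130) above was unverified and is withdrawn (cross-read I-2): (1.130) merely carries the same `11d²`), and
  the data are bounded through the SUP of (1.80) (`e^{−δdist} ≤ 1`, `bound180_uniform`).  The cube
  condition is fed by the Prop. 6 [14] shape (Part D, `Shape1136`): scaled potential and derivative `< Bg·(CM)·(data)`,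
  `Bg` absolute (`7dL²B₁` in print).

WHAT THIS FILE TYPES AND PROVES (all `theorem`s; rows = the space-constant restrictions the repair consumes).
* Part A (`lfFactor_top`, `lfFactor_top_ge`, `three_lfFactor_top_ge`, `cConst_top`, `cConst_below`, `unit_entry2_top`).
* Part B — ROW R1 (entries 1 = 5): `clause168_top_of_180` — a plaquette within (1.80) meets the top-rung line as soon as
  `(2 + C·B₃B₅M⁵)ε_k ≤ 3·lfFactor β h j k k·α_{0,k}`; explicit sufficient form `(2 + C·B₃B₅M⁵)ε_k ≤ (9/4)α_{0,k}` for
  `β ∈ [0, 1/4]`, `j < k` (`rowR1_of_explicit`); `bare_two_fits_top` ∕ `bare_two_fails_c_one` — AT THE TOP-RUNG UNIT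
  (gain `1`) the bare summand `2ε_kη²` (the first term of (1.80); (1.75)'s inf-sup bound) fits under the top-rung radius
  for `0 < ε_k ≤ α_{0,k}` BECAUSE `c = 3` (`2 < 9/4 ≤ 3·lfFactor`), and would not fit under the factor `c = 1` whenever
  `α_{0,k} ≤ 2ε_k` — a statement about the top-rung line IF a bound with that leading term is its datum (READING L of
  (r1′)); below the top rung the unit's gain `L^{2(k−m)} ≥ 4` rescues `c = 1` (Part F `bare_two_fits_rung`), and under
  READING C the bare first term is consumed in print only there ([IV] p. 200, for the lines of (1.24): C-b02g24-1
  (2)(iv), C-adv8-36 (i)); `rowR1_necessary` — inside the schematic model the row is sharp (if it fails strictly, a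
  plaquette value admitted by (1.80) violates the clause).
* Part C — ROW R2 (entry 2, every `p = 1,…,k`): `clause168_top_entry2` — `2B₃K(2 + C·B₃B₅M⁵)ε_k ≤ 3·lfFactor·α_{0,k}`,
  whose product `4B₃Kε_k + 2C·B₃²B₅M⁵Kε_k` (`rowR2_product`) carries `B₃` TWICE — the kernel form of G-adv3-18 (1)
  (*"a SECOND power of B₃B₅M⁵ in the required space-constant restriction"*) with, on the top rung, NO factor
  `L₀^{−2(m−k₀)}` and the constant `c = 3`; `rowR1_of_rowR2` (R2 ⇒ R1 once `2B₃K ≥ 1`: the local-minimizer class is the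
  binding one); `rowR2_necessary` (sharp inside the model).
* Part D — ROW R3 (cube condition, weight `W ≥ 1`): `cube165_of_shape` — `Bg·(2 + C·B₃B₅M⁵)ε_k ≤ B·α_{0,k}` (ONE power
  of `B₃`; the cube size `CM` cancels); `rowR3_of_le` — no new constant when `B ≥ Bg` (p. 191 *"we can take the
  constant B = B₃"*): then R3 follows from `(2 + C·B₃B₅M⁵)ε_k ≤ α_{0,k}`.
* Part E — `MemberTopReal` (the conjunction of the R1/R2 clauses for entries 1, 2 (all `p`), 5 and the cube pair at
  `m = k`) and `memberTopReal_of_rows` (THE CENSUS ASSEMBLED: hypotheses (1.80), the (1.17)-shape per `p` with data under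
  the sup of (1.80), the Prop. 6-shape with the same data, signs, and the three rows ⇒ membership); `rows_of_binding`
  (with `2B₃K ≥ 3`, `Bg ≤ B`: the single comparison R2 gives R1 and R3); `rowR2_of_exponents` — UNDER THE READING
  `ε_k = g_kA₀x^{p₀}` ((2.4) [III]) and `α_{0,k} = g_kC₀x^{q₀}` ((2.28) [III]), `x = log g_k^{−2} ≥ 1`, row R2 holds at
  every coupling as soon as `p₀ ≤ q₀` and `2B₃K(2 + C·B₃B₅M⁵)A₀ ≤ 3(1−β)C₀` (the printed *"C₀ … sufficiently large"*,
  here: large against `B₃²B₅M⁵`), by `B14Radii.fits_of_exponents`; `rowR2_exponent_necessary` — `p₀ ≤ q₀` is necessary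
  for the row to survive at small couplings (`B14Radii.exponent_necessary`, reconstruction of the cell, SMALLNESS.md
  §4.1 (X12), not a printed restriction); `clause168_of_zero` (r2).
* Part F (v1.2) — BELOW THE TOP RUNG and SHAPE-ONLY: `lfFactor_rung` (closed form of the factor for every `m ≥ j`:
  `1 − 2β·2^{−(m−j)} + 2β·2^{−(m−h)} − β + β·2^{−(k−m)}`), `lfFactor_rung_ge` (`≥ 1 − 2β` for `j + 1 ≤ m`),
  `unit_entry12_rung` (entries 1 and 2 share the unit `α_{0,m}L^{2(k−m)}η²`: gain `G = L^{2(k−m)}` below the top);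
  `clause168_top_of_bound`, `hstarShape_within_uniform`, `clause168_top_of_hstar` (Part B consumes only the shape;
  the (H*)-shape is inside it for `C ≥ 2`); ROWS BELOW THE TOP: `clause168_rung_of_bound` ∕ `clause168_rung_of_180`
  (entry 1 = 5 at a rung `m < k`: `(2 + C·B₃B₅M⁵)ε_k ≤ lfFactor β h j m k·α_{0,m}G`, `c = 1`), `clause168_rung_entry2`
  (entry 2: `2B₃K(2 + C·B₃B₅M⁵)ε_k ≤ lfFactor β h j m k·α_{0,m}G`); DOMINANCE `rowRung_of_top` ∕ `rungRows_of_top`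
  (THE TOP RUNG BINDS: a top-rung row implies the rung-`m` row under the side condition `3α_{0,k} ≤ (1 − 2β)α_{0,m}G`,
  e.g. `6α_{0,k} ≤ α_{0,m}L^{2(k−m)}` at `β = 1/4`); `bare_two_fits_rung` (with `G ≥ 4`, `β ≤ 1/4`, `0 ≤ ε_k < α_{0,m}`
  the bare `2ε_kη²` fits under `c = 1` — the contrast to `bare_two_fails_c_one`); WEIGHTED LINES
  `clause164_of_unweighted`, `clause164_of_bound`, `clause164i_of_180`, `clause166_of_180` (a weight `W ≥ 1` —
  `W164`, `W166` for `L₀ ≥ 1` — only enlarges a nonnegative radius, so the (i)/(ii) entry-1 clauses follow from the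
  unweighted row).  All rows are hypotheses on constants; the memberships below the top rung are not assembled (NOT
  CERTIFIED (c)).
NOT CERTIFIED HERE (located only; census GAPS.md C-b01g26-1, C-b01g27-1).  (a) (1.80) itself (GAPS G-r2.4b(ii): deferred on p. 195,
not returned to in [V] pp. 358–359, used on [V] p. 361).  (b) The located shapes AS THEOREMS for these objects:
Proposition 9 ∕ Theorem 1 [15] for the X-localized sets `𝔹_p(X) ∪ {Γ^{(n)}_i}_{i<p}` whose constraint data come from
`U₀ = U(𝔹_k(Z), M˙(Q^{s*}_kV_Λ))` (two different set systems — G-adv3-18 (1), "background of the background"), and the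
applicability threshold of Proposition 6 [14], `7dL²·CM·(data) ≤ c₁` — a further `ε_k`-small row R3′, not typed.
(c) The MEMBERSHIPS off the top rung: the parts of the domains `X` in `(Ω_m∖Ω_{m+1})`, `m < k`, and in the
`Ω″`-layers, in particular near and inside `Λ ⊂ (Ω^{~4}_{k₀+1})^c` (p. 192 (1.73)), where the clauses are (1.68)(iii)
with `c = 1` and the `L₀`-weighted (1.64)(i) ∕ (1.66)(ii), and the printed bounds on `U₀` are (1.80) on its USED domain
`Z ∩ Ω_k^c` (READING C of (r1′); [IV] p. 197 l. 9 derives (1.84) from (1.80), (1.65) [14] and (1.83) inside `Λ` —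
C-b02g24-1 (2)(ii)) and (1.83), (1.84), (1.87) (scales `B₅M⁶`, `B₃B₅M⁶`, `B₃²B₅M⁶`); v1.2 Part F types the ROWS of
these lines for the entries a (1.80)-shaped datum feeds and their dominance by the top-rung row, not the memberships
(inside `Λ` the data are (1.83) ∕ (1.84) ∕ (1.87)-shaped, larger than (1.80)'s by a power of `M`, and the side
condition of `rowRung_of_top` on `α̃₀` is a hypothesis); v1 ∕ v1.1's clause *"none of it is reachable from (1.80) as
printed (for p ∈ Ω_k)"* is true of the printed domain clause only (READING L) and is superseded by (r1′); the
`L₀^{−2(m−k₀)}`-weighted restriction named in G-adv3-18 refers to these rungs.  (d) The first half of the sentence, *"the integration domain determined by the characteristic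
function χ″_k in (1.76)"*: it concerns `V₀ = M_{𝔹″_k}(U₀)` of (1.81) against the restrictions of `χ″_k` (p. 193 l. 15)
and is discharged in print by other means (p. 196: *"We can prove that it satisfies |V′ − 1| < O(1)M²NR_k⁴ε_k on 𝔹₀ …
the functions χ_{k,Λ}, χ′ should allow us to remove the function χ″_k"*; input regularity of Proposition 1: GAPS
G-B15-07) — not typed.  (e) Class R4, the current entries (r2).  (f) The identification of B15's `ε_k`, `α̃₀ = {α_{0,m}}`
with [III] (2.4)/(2.28) (`…B15.ComplexSpaces` Part E and GAPS C-b01g25-1 (c); [III] p. 261 defines the spaces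
`Ũ^c_j(X, α̃₀, α̃₁)` by (2.34)–(2.39) in those units, GAPS C-b02g22-1 D-1) — Part E's two theorems are conditional on it.
VERSIONS.  v1 = p191578 (commit 00e2ec1be478; 26 declarations).  v1.1 (same unit and generation) = DOCSTRING-ONLY fold of
the cross-read GAPS C-adv8-90 (unit adv8, verdict ok ∕ CONSISTENT, misquotations 0): D-1 (the printed sup domain
`p ∈ Ω_k^c` of (1.75) restored), D-2 (render list completed), I-2 ((1.65) [14] located on B8 p. 87 instead of an unverified
identification with (1.130)); NO declaration added, removed or changed.  v1.2 (generation 27) = (A) READING-NEUTRAL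
header: (r1) split into the definition-side statement and the domain paragraph (r1′) displaying the cell's two readings
of (1.80)'s printed domain with their located support (GAPS G-adv7-25, unit adv7; C-b02g24-1 (5c) and its consistency
flag, unit b02), (r3) and the Part B gloss re-sourced to the SHAPE of (1.80), NOT CERTIFIED (c) rewritten; (B) Part F
APPENDED (16 theorems, listed above; nothing else in the code changed); (C) DOCSTRING fold of the cross-read GAPS
C-adv3-80 (unit adv3, verdict ok, misquotations 0/18): D2 (the domain of [I] (1.17) is `X̃^{−2}`, [I] p. 262), I1–I3
(docstrings of `three_lfFactor_top_ge`, `rowR3_of_le`, `Shape1136`); the 26 declarations of v1 ∕ v1.1 are unchanged in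
statement and proof.  Census: GAPS.md C-b01g27-1.  v1.3 (generation 27) = DOCSTRING-ONLY fold of the cross-read GAPS
C-adv3-87 (unit adv3, verdict ok ∕ CONSISTENT, kernel 16/16, ABSOLUTE-RULE 0, misquotations 1): D1 (B15 p. 177 quoted in
full instead of a paraphrase inside quotation marks), D2 (`Z` = the union of the admissible components, `X` a component),
P1 (the top-rung geometry under READING L stated with the `LMR`-cube layers and the parallelepiped-hull modification of
[III] p. 269), P2 (scope note on `lfFactor_rung`); NO declaration added, removed or changed.
Value = a kernel-certified repair census for a filed deferral (which line, which constants, which rows, sharp inside the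
model; v1.2: neutral as to the printed domain of (1.80)), NOT summit progress.  Unit `b2b-balaban-b01` (fallback seat,
PHASE-2 row P15), generations 26 (v1, v1.1) and 27 (v1.2, v1.3).
-/

open scoped BigOperators
open Finset

namespace Literature.MathematicalPhysics.QuantumFieldTheory.Balaban1983to89.B15.Membership195

open BasicStep (lfFactor)
open ComplexSpaces (Clause164 Clause168 cConst Cube165 sum_half_pow_eq lfFactor_le_one)

/-! ## Part A. The top-rung factor `lfFactor β h j k k` in closed form. -/

section TopFactor

/-- On the top rung `m = k` the second printed sum is empty and the first is geometric:
`lfFactor β h j k k = 1 − 2β·2^{−(k−j)} + 2β·2^{−(k−h)}` (`h ≤ j ≤ k`). [cite: Balaban1989LargeFieldI, (1.68) p.191] -/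
theorem lfFactor_top (β : ℝ) {h j k : ℕ} (hhj : h ≤ j) (hjk : j ≤ k) :
    lfFactor β h j k k = 1 - 2 * β * (1 / 2 : ℝ) ^ (k - j) + 2 * β * (1 / 2 : ℝ) ^ (k - h) := by
  unfold lfFactor
  have hsum2 : ∑ n ∈ Finset.range (k - k), (1 / 2 : ℝ) ^ (n + 1) = 0 := by simp
  have hterm : ∀ n ∈ Finset.range (j - h),
      (1 / 2 : ℝ) ^ Int.natAbs ((k : ℤ) - (h + 1 + n : ℕ)) = (1 / 2 : ℝ) ^ (k - j) * (1 / 2 : ℝ) ^ (j - h - 1 - n) := by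
    intro n hn
    rw [Finset.mem_range] at hn
    have e : Int.natAbs ((k : ℤ) - (h + 1 + n : ℕ)) = (k - j) + (j - h - 1 - n) := by omega
    rw [e, pow_add]
  have hsum1 : ∑ n ∈ Finset.range (j - h), (1 / 2 : ℝ) ^ Int.natAbs ((k : ℤ) - (h + 1 + n : ℕ))
      = (1 / 2 : ℝ) ^ (k - j) * (2 - 2 * (1 / 2 : ℝ) ^ (j - h)) := by
    rw [Finset.sum_congr rfl hterm, ← Finset.mul_sum]
    congr 1
    rw [Finset.sum_range_reflect (fun t => (1 / 2 : ℝ) ^ t) (j - h)]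
    exact sum_half_pow_eq (j - h)
  rw [hsum1, hsum2]
  have hkj : (1 / 2 : ℝ) ^ (k - h) = (1 / 2 : ℝ) ^ (k - j) * (1 / 2 : ℝ) ^ (j - h) := by
    rw [← pow_add]; congr 1; omega
  rw [hkj]; ring

/-- Hence, one rung below the top or lower (`j + 1 ≤ k`, `β ≥ 0`): `1 − β ≤ lfFactor β h j k k ≤ 1`. [folklore] -/
theorem lfFactor_top_ge {β : ℝ} (hβ : 0 ≤ β) {h j k : ℕ} (hhj : h ≤ j) (hjk : j + 1 ≤ k) :
    1 - β ≤ lfFactor β h j k k := by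
  rw [lfFactor_top β hhj (by omega)]
  have hy : (1 / 2 : ℝ) ^ (k - j) ≤ 1 / 2 := by
    calc (1 / 2 : ℝ) ^ (k - j) ≤ (1 / 2 : ℝ) ^ 1 := pow_le_pow_of_le_one (by norm_num) (by norm_num) (by omega)
      _ = 1 / 2 := by norm_num
  have hx : 0 ≤ (1 / 2 : ℝ) ^ (k - h) := by positivity
  nlinarith

/-- With the printed `β ≤ 1/4` ([Balaban1988Convergent] p.261 *"e.g., we can take β = 1/4"* — as quoted in the imported
tree module `…B14Radii`, l. 141, same cite tag, not re-read here; B15 p.191 *"if β ≦ 1/4"*) the top-rung radius factor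
`c·lfFactor = 3·lfFactor β h j k k` is at least `9/4 > 2`. [folklore] -/
theorem three_lfFactor_top_ge {β : ℝ} (hβ0 : 0 ≤ β) (hβ : β ≤ 1 / 4) {h j k : ℕ} (hhj : h ≤ j) (hjk : j + 1 ≤ k) :
    9 / 4 ≤ 3 * lfFactor β h j k k := by
  have := lfFactor_top_ge hβ0 hhj hjk
  linarith

/-- `cConst k k = 3` (p.191: *"c = 3 for m = k"*). [cite: Balaban1989LargeFieldI, (1.68) p.191] -/
theorem cConst_top (k : ℕ) : cConst k k = 3 := by
  unfold cConst; simp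

/-- `cConst m k = 1` for `m < k`. [cite: Balaban1989LargeFieldI, (1.68) p.191] -/
theorem cConst_below {m k : ℕ} (h : m < k) : cConst m k = 1 := by
  unfold cConst; simp [h]


/-- The printed units of the first two entries coincide at the top rung: with `η = L^{−k}`,
`L^{−2p}(L^kL^{−p})^{−2} = η² = η²(L^kη)^{−2}` (`L ≠ 0`) — so rows R1 and R2 below are stated in the single unit
`α_{0,k}η²`. [cite: Balaban1989LargeFieldI, (1.68) p.191] -/
theorem unit_entry2_top {L : ℝ} (hL : L ≠ 0) (p k : ℕ) :
    (L ^ p)⁻¹ ^ 2 * ((L ^ k * (L ^ p)⁻¹) ^ 2)⁻¹ = ((L ^ k)⁻¹) ^ 2 ∧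
      ((L ^ k)⁻¹) ^ 2 * ((L ^ k * (L ^ k)⁻¹) ^ 2)⁻¹ = ((L ^ k)⁻¹) ^ 2 := by
  have hp : L ^ p ≠ 0 := pow_ne_zero _ hL
  have hk : L ^ k ≠ 0 := pow_ne_zero _ hL
  constructor
  · field_simp
  · field_simp

end TopFactor

/-! ## Part B. The bound (1.80) feeding the top-rung clause of (1.68)(iii): entries `|∂𝕌 − 1| = |∂U − 1|`. -/

section Plaquettes

/-- (1.80) with the exponential dropped: `|U₀(∂p) − 1| < (2 + C·B₃B₅M⁵)ε_kη²` (`C·B₃B₅M⁵ ≥ 0`, `ε_k ≥ 0`,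
`δ·dist(p,Λ) ≥ 0`). [cite: Balaban1989LargeFieldI, (1.80) p.195] -/
theorem bound180_uniform {d εk η B₃ B₅ M δ dist C : ℝ} (h180 : Ineq180 d εk η B₃ B₅ M δ dist C)
    (hX : 0 ≤ C * B₃ * B₅ * M ^ 5) (hε : 0 ≤ εk) (hδ : 0 ≤ δ * dist) :
    d < (2 + C * B₃ * B₅ * M ^ 5) * εk * η ^ 2 := by
  unfold Ineq180 at h180
  have hexp : Real.exp (-δ * dist) ≤ 1 := by
    rw [Real.exp_le_one_iff]
    have : -δ * dist = -(δ * dist) := by ring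
    linarith [this]
  have h1 : C * B₃ * B₅ * M ^ 5 * Real.exp (-δ * dist) * εk * η ^ 2 ≤ C * B₃ * B₅ * M ^ 5 * 1 * εk * η ^ 2 := by
    apply mul_le_mul_of_nonneg_right _ (sq_nonneg η)
    apply mul_le_mul_of_nonneg_right _ hε
    exact mul_le_mul_of_nonneg_left hexp hX
  have h2 : (2 + C * B₃ * B₅ * M ^ 5) * εk * η ^ 2 = 2 * εk * η ^ 2 + C * B₃ * B₅ * M ^ 5 * 1 * εk * η ^ 2 := by ring
  linarith

/-- ROW R1 (entries `|∂𝕌 − 1|` and, on the real slice `U′ = 1`, `|∂U − 1|`): the top-rung line of (1.68)(iii) —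
`c = 3`, no power of `L₀`, unit `α_{0,k}η²(L^kη)^{−2} = α_{0,k}η²` — holds for a plaquette obeying (1.80) as soon as
`(2 + C·B₃B₅M⁵)ε_k ≤ 3·lfFactor β h j k k·α_{0,k}`. [folklore] -/
theorem clause168_top_of_180 {d εk η B₃ B₅ M δ dist C β α₀ : ℝ} {h j k : ℕ}
    (h180 : Ineq180 d εk η B₃ B₅ M δ dist C) (hX : 0 ≤ C * B₃ * B₅ * M ^ 5) (hε : 0 ≤ εk) (hδ : 0 ≤ δ * dist)
    (hrow : (2 + C * B₃ * B₅ * M ^ 5) * εk ≤ 3 * lfFactor β h j k k * α₀) :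
    Clause168 d β h j k k (cConst k k) (α₀ * η ^ 2) := by
  unfold Clause168 Clause164
  rw [cConst_top]
  have h1 := bound180_uniform h180 hX hε hδ
  have h2 : (2 + C * B₃ * B₅ * M ^ 5) * εk * η ^ 2 ≤ 3 * lfFactor β h j k k * α₀ * η ^ 2 :=
    mul_le_mul_of_nonneg_right hrow (sq_nonneg η)
  calc d < (2 + C * B₃ * B₅ * M ^ 5) * εk * η ^ 2 := h1
    _ ≤ 3 * lfFactor β h j k k * α₀ * η ^ 2 := h2
    _ = lfFactor β h j k k * 3 * (α₀ * η ^ 2) := by ring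

/-- A sufficient EXPLICIT form of row R1 (`β ∈ [0, 1/4]`, `h ≤ j < k`, `α_{0,k} ≥ 0`):
`(2 + C·B₃B₅M⁵)ε_k ≤ (9/4)α_{0,k}`. [folklore] -/
theorem rowR1_of_explicit {X εk β α₀ : ℝ} {h j k : ℕ} (hβ0 : 0 ≤ β) (hβ : β ≤ 1 / 4) (hhj : h ≤ j)
    (hjk : j + 1 ≤ k) (hα : 0 ≤ α₀) (hle : (2 + X) * εk ≤ 9 / 4 * α₀) :
    (2 + X) * εk ≤ 3 * lfFactor β h j k k * α₀ := by
  have hF := three_lfFactor_top_ge hβ0 hβ hhj hjk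
  nlinarith

/-- The bare leading term AT THE TOP-RUNG UNIT: with `β ≤ 1/4`, `j < k` and `0 < ε_k ≤ α_{0,k}` the summand `2ε_kη²`
(the first term of (1.80); the inf-sup bound of (1.75)) alone fits under the top-rung radius `3·lfFactor·α_{0,k}η²` —
IF a bound with that leading term is the top-rung datum (READING L of the header (r1′); under READING C it is not, and
the bare term is consumed below the top rung, `bare_two_fits_rung`), the printed `c = 3` at `m = k` is what makes room
for the `2`. [folklore] -/
theorem bare_two_fits_top {εk β α₀ η : ℝ} {h j k : ℕ} (hβ0 : 0 ≤ β) (hβ : β ≤ 1 / 4) (hhj : h ≤ j)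
    (hjk : j + 1 ≤ k) (hε : 0 < εk) (hεα : εk ≤ α₀) (hη : η ≠ 0) :
    Clause168 (2 * εk * η ^ 2) β h j k k (cConst k k) (α₀ * η ^ 2) := by
  unfold Clause168 Clause164
  rw [cConst_top]
  have hF := three_lfFactor_top_ge hβ0 hβ hhj hjk
  have hη2 : 0 < η ^ 2 := by positivity
  have : 2 * εk < 3 * lfFactor β h j k k * α₀ := by nlinarith
  calc 2 * εk * η ^ 2 < 3 * lfFactor β h j k k * α₀ * η ^ 2 := mul_lt_mul_of_pos_right this hη2
    _ = lfFactor β h j k k * 3 * (α₀ * η ^ 2) := by ring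

/-- … whereas with the factor `c = 1` of the lower rungs but STILL AT THE TOP-RUNG UNIT (gain `1`) the bare term does
NOT fit whenever `α_{0,k} ≤ 2ε_k` (`β ≥ 0`, `α_{0,k} ≥ 0`): the clause `2ε_kη² < lfFactor·1·α_{0,k}η²` fails; on an
actual lower rung the unit carries the gain `L^{2(k−m)} ≥ 4`, which changes the verdict (Part F `bare_two_fits_rung`).
[folklore] -/
theorem bare_two_fails_c_one {εk β α₀ η : ℝ} {h j k : ℕ} (hβ0 : 0 ≤ β) (hα : 0 ≤ α₀) (hαε : α₀ ≤ 2 * εk) :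
    ¬ Clause168 (2 * εk * η ^ 2) β h j k k 1 (α₀ * η ^ 2) := by
  unfold Clause168 Clause164
  intro hlt
  have hF := lfFactor_le_one hβ0 h j k k
  have hη2 : 0 ≤ η ^ 2 := sq_nonneg η
  have h1 : lfFactor β h j k k * 1 * (α₀ * η ^ 2) ≤ 1 * 1 * (α₀ * η ^ 2) :=
    mul_le_mul_of_nonneg_right (mul_le_mul_of_nonneg_right hF zero_le_one) (mul_nonneg hα hη2)
  have h2 : 1 * 1 * (α₀ * η ^ 2) ≤ 2 * εk * η ^ 2 := by nlinarith
  linarith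

/-- SHARPNESS of row R1 inside the schematic model: if the row fails strictly, `3·lfFactor·α_{0,k} <
(2 + C·B₃B₅M⁵e^{−δdist})ε_k`, some plaquette value admitted by (1.80) violates the top-rung clause (`η ≠ 0`).
[folklore] -/
theorem rowR1_necessary {εk η B₃ B₅ M δ dist C β α₀ : ℝ} {h j k : ℕ} (hη : η ≠ 0)
    (hfail : 3 * lfFactor β h j k k * α₀ < (2 + C * B₃ * B₅ * M ^ 5 * Real.exp (-δ * dist)) * εk) :
    ∃ d : ℝ, Ineq180 d εk η B₃ B₅ M δ dist C ∧ ¬ Clause168 d β h j k k (cConst k k) (α₀ * η ^ 2) := by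
  have hη2 : 0 < η ^ 2 := by positivity
  refine ⟨3 * lfFactor β h j k k * α₀ * η ^ 2, ?_, ?_⟩
  · unfold Ineq180
    have := mul_lt_mul_of_pos_right hfail hη2
    calc 3 * lfFactor β h j k k * α₀ * η ^ 2 < (2 + C * B₃ * B₅ * M ^ 5 * Real.exp (-δ * dist)) * εk * η ^ 2 := this
      _ = 2 * εk * η ^ 2 + C * B₃ * B₅ * M ^ 5 * Real.exp (-δ * dist) * εk * η ^ 2 := by ring
  · unfold Clause168 Clause164
    rw [cConst_top]
    intro hlt
    have : lfFactor β h j k k * 3 * (α₀ * η ^ 2) = 3 * lfFactor β h j k k * α₀ * η ^ 2 := by ring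
    linarith

end Plaquettes

/-! ## Part C. The entry `|∂U_{p,X}(M˙(𝕌)) − 1|`: a Theorem-1-[15]-type shape applied to data of size (1.80). -/

section LocalMinimizers

/-- The located shape for the second entry class ([Balaban1987RG1] p.263 (1.17), verbatim: *"|∂U_n(M˙(𝐔)) − 1| <
B₃2α₀′L^{−2n}(Lⁿξ)² = 2B₃α₀′ξ²"* for data `|∂𝐔 − 1| < α₀′·(unit)`; [Balaban1989LargeFieldII] p.361 *"Using the estimate
(1.80) [IV] and Theorem 1 [15]"*): the deviation `d₂` of a local minimal configuration built on the averages of `𝕌` is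
at most `2B₃·K` times the data bound `D` of `𝕌`, `K` an averaging constant (B15 p.197 l.9 carries *"11d²"* from
*"(1.65) [14]"*).  Schematic hypothesis shape, nothing asserted. [cite: Balaban1987RG1, (1.17) p.263] -/
def Shape117 (d₂ B₃ K D : ℝ) : Prop := d₂ < 2 * B₃ * K * D

/-- ROW R2 (entry `|∂U_{p,X}(M˙U₀) − 1|`, every `p`): with data `D ≤ (2 + C·B₃B₅M⁵)ε_kη²` (sup of (1.80)) the top-rung
line of (1.68)(iii) holds as soon as `2B₃K·(2 + C·B₃B₅M⁵)ε_k ≤ 3·lfFactor β h j k k·α_{0,k}` — the space-constant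
restriction carries `B₃` TWICE (product `2C·B₃²B₅M⁵·K·ε_k`). [folklore] -/
theorem clause168_top_entry2 {d₂ B₃ K D εk η B₅ M C β α₀ : ℝ} {h j k : ℕ} (h117 : Shape117 d₂ B₃ K D)
    (hK : 0 ≤ 2 * B₃ * K) (hD : D ≤ (2 + C * B₃ * B₅ * M ^ 5) * εk * η ^ 2)
    (hrow : 2 * B₃ * K * ((2 + C * B₃ * B₅ * M ^ 5) * εk) ≤ 3 * lfFactor β h j k k * α₀) :
    Clause168 d₂ β h j k k (cConst k k) (α₀ * η ^ 2) := by
  unfold Shape117 at h117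
  unfold Clause168 Clause164
  rw [cConst_top]
  have h1 : 2 * B₃ * K * D ≤ 2 * B₃ * K * ((2 + C * B₃ * B₅ * M ^ 5) * εk * η ^ 2) := mul_le_mul_of_nonneg_left hD hK
  have h2 : 2 * B₃ * K * ((2 + C * B₃ * B₅ * M ^ 5) * εk) * η ^ 2 ≤ 3 * lfFactor β h j k k * α₀ * η ^ 2 :=
    mul_le_mul_of_nonneg_right hrow (sq_nonneg η)
  calc d₂ < 2 * B₃ * K * D := h117
    _ ≤ 2 * B₃ * K * ((2 + C * B₃ * B₅ * M ^ 5) * εk * η ^ 2) := h1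
    _ = 2 * B₃ * K * ((2 + C * B₃ * B₅ * M ^ 5) * εk) * η ^ 2 := by ring
    _ ≤ 3 * lfFactor β h j k k * α₀ * η ^ 2 := h2
    _ = lfFactor β h j k k * 3 * (α₀ * η ^ 2) := by ring

/-- The product in row R2 written out: `2B₃K(2 + C·B₃B₅M⁵)ε_k = 4B₃Kε_k + 2C·B₃²B₅M⁵Kε_k`. [folklore] -/
theorem rowR2_product (B₃ K C B₅ M εk : ℝ) :
    2 * B₃ * K * ((2 + C * B₃ * B₅ * M ^ 5) * εk) = 4 * B₃ * K * εk + 2 * C * B₃ ^ 2 * B₅ * M ^ 5 * K * εk := by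
  ring

/-- Row R2 implies row R1 when `2B₃K ≥ 1` (the located constants have `B₃ ≥ 1`, `K ≥ 1`): the second entry class is
the binding one. [folklore] -/
theorem rowR1_of_rowR2 {B₃ K X εk F α₀ : ℝ} (hK : 1 ≤ 2 * B₃ * K) (hXε : 0 ≤ X * εk)
    (hrow : 2 * B₃ * K * (X * εk) ≤ F * α₀) : X * εk ≤ F * α₀ := by
  nlinarith

/-- SHARPNESS of row R2 inside the schematic model (`η ≠ 0`): if `3·lfFactor·α_{0,k} <
2B₃K(2 + C·B₃B₅M⁵)ε_k`, there are data `D` within (1.80) and a deviation `d₂` within the (1.17)-shape violating the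
top-rung clause. [folklore] -/
theorem rowR2_necessary {B₃ K εk η B₅ M C β α₀ : ℝ} {h j k : ℕ} (hη : η ≠ 0)
    (hfail : 3 * lfFactor β h j k k * α₀ < 2 * B₃ * K * ((2 + C * B₃ * B₅ * M ^ 5) * εk)) :
    ∃ D d₂ : ℝ, D ≤ (2 + C * B₃ * B₅ * M ^ 5) * εk * η ^ 2 ∧ Shape117 d₂ B₃ K D ∧
      ¬ Clause168 d₂ β h j k k (cConst k k) (α₀ * η ^ 2) := by
  have hη2 : 0 < η ^ 2 := by positivity
  refine ⟨(2 + C * B₃ * B₅ * M ^ 5) * εk * η ^ 2, 3 * lfFactor β h j k k * α₀ * η ^ 2, le_rfl, ?_, ?_⟩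
  · unfold Shape117
    have := mul_lt_mul_of_pos_right hfail hη2
    calc 3 * lfFactor β h j k k * α₀ * η ^ 2 < 2 * B₃ * K * ((2 + C * B₃ * B₅ * M ^ 5) * εk) * η ^ 2 := this
      _ = 2 * B₃ * K * ((2 + C * B₃ * B₅ * M ^ 5) * εk * η ^ 2) := by ring
  · unfold Clause168 Clause164
    rw [cConst_top]
    intro hlt
    have : lfFactor β h j k k * 3 * (α₀ * η ^ 2) = 3 * lfFactor β h j k k * α₀ * η ^ 2 := by ring
    linarith

end LocalMinimizers

/-! ## Part D. The cube condition (1.69) at the top rung: a Proposition-6-[14]-type shape. -/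

section Cubes

/-- The located shape for the cube condition ([Balaban1985RegularSpaces] Prop. 6 (1.136) p.99, verbatim: *"L^jη|A|,
(L^jη)²|∇^ηA|, (L^jη)³|∂^{η*}∂^ηA|, (L^jη)³|Δ^ηA| < 7dL²B₁Mα₀ on □_j"* for `U₀ ∈ 𝔄_k(α₀)` and a cube of size
parameter `M`, under `7dL²Mα₀ ≤ c₁`): in a suitable gauge the scaled potential and its derivative are at most
`Bg·M_□·D`, `Bg` an absolute constant (`7dL²B₁` there), `M_□` the size parameter of the cube, `D` the data bound.
Of the four printed quantities of (1.136) only the first two (`L^jη|A|`, `(L^jη)²|∇^ηA|`) are typed, matching the two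
conjuncts of `ComplexSpaces.Cube165` — (1.65) ∕ (1.69) display exactly these two.  Schematic hypothesis shape, nothing
asserted. [cite: Balaban1985RegularSpaces, Prop. 6 (1.136) p.99] -/
def Shape1136 (a da Bg Mc D : ℝ) : Prop := a < Bg * Mc * D ∧ da < Bg * Mc * D

/-- ROW R3 (cube condition (1.65)/(1.69), weight `W ≥ 1`, cube size parameter `C′M`): holds as soon as `Bg·D ≤ B·α₀`
— with data `D ≤ (2 + C·B₃B₅M⁵)ε_k` (rung units) this is `Bg(2 + C·B₃B₅M⁵)ε_k ≤ Bα_{0,k}`: ONE power of `B₃`, and no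
new constant if `B ≥ Bg` (p.191: *"B is a fixed absolute constant, for example we can take the constant B = B₃"*).
[folklore] -/
theorem cube165_of_shape {a da Bg C' M D W B α₀ : ℝ} (h1136 : Shape1136 a da Bg (C' * M) D) (hW : 1 ≤ W)
    (hCM : 0 ≤ C' * M) (hD : 0 ≤ D) (hBg : 0 ≤ Bg) (hrow : Bg * D ≤ B * α₀) : Cube165 a da W B C' M α₀ := by
  obtain ⟨ha, hda⟩ := h1136
  have h1 : Bg * (C' * M) * D ≤ B * C' * M * α₀ := by
    have := mul_le_mul_of_nonneg_left hrow hCM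
    calc Bg * (C' * M) * D = C' * M * (Bg * D) := by ring
      _ ≤ C' * M * (B * α₀) := this
      _ = B * C' * M * α₀ := by ring
  have h0 : 0 ≤ B * C' * M * α₀ := le_trans (by positivity) h1
  have h2 : B * C' * M * α₀ ≤ W * (B * C' * M * α₀) := by nlinarith
  exact ⟨by linarith, by linarith⟩

/-- Row R3 needs no new constant when `B ≥ Bg` (p.191: *"we can take the constant B = B₃"*): it follows from the
comparison `D ≤ α₀` alone — if `0 ≤ Bg ≤ B` and `0 ≤ D ≤ α₀` then `Bg·D ≤ B·α₀` (in `rows_of_binding` the premise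
`(2 + C·B₃B₅M⁵)ε_k ≤ α_{0,k}` is obtained from row R2 and `2B₃K ≥ 3`). [folklore] -/
theorem rowR3_of_le {Bg B D α₀ : ℝ} (hBg : 0 ≤ Bg) (hB : Bg ≤ B) (hD : 0 ≤ D) (hDα : D ≤ α₀) : Bg * D ≤ B * α₀ := by
  have hα : 0 ≤ α₀ := le_trans hD hDα
  calc Bg * D ≤ Bg * α₀ := mul_le_mul_of_nonneg_left hDα hBg
    _ ≤ B * α₀ := mul_le_mul_of_nonneg_right hB hα

end Cubes

/-! ## Part E. The real-slice membership at the top rung, assembled; and the rows against (2.4)/(2.28) [III]. -/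

section Assembly

/-- (r2) A vanishing entry (`A′ = 0`: the sixth and seventh quantities; under the reading `𝕁 = 0` also the third and
fourth) meets its clause as soon as the radius is positive: `0 < lfFactor`, `0 < c`, `0 < unit`. [folklore] -/
theorem clause168_of_zero {β c E : ℝ} {h j m k : ℕ} (hF : 0 < lfFactor β h j m k) (hc : 0 < c) (hE : 0 < E) :
    Clause168 0 β h j m k c E := by
  unfold Clause168 Clause164
  positivity

/-- The real-slice reading of one point of `Ω_k ∩ X` for the pair `(U₀, 0)`: of the seven entries of (1.68)(iii) the
three `|𝕁|`, `|J_{p,X}|`, `|A′|, |∇A′|`-entries vanish (`𝕁 = 0`, `U′ = 1`), `|∂U − 1| = |∂𝕌 − 1|`; what remains is the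
plaquette entry `d₁`, the local-minimizer entries `d₂ p` (`p = 1,…,k`), and the cube pair `(a, da)`.  Schematic
conjunction of the printed clauses (`ComplexSpaces.Clause168`, `ComplexSpaces.Cube165` with weight `1`). [cite: Balaban1989LargeFieldI, (1.68)–(1.69) p.191] -/
def MemberTopReal (d₁ : ℝ) (d₂ : ℕ → ℝ) (a da β : ℝ) (h j k : ℕ) (B C' M α₀ η : ℝ) : Prop :=
  Clause168 d₁ β h j k k (cConst k k) (α₀ * η ^ 2) ∧
    (∀ p, 1 ≤ p → p ≤ k → Clause168 (d₂ p) β h j k k (cConst k k) (α₀ * η ^ 2)) ∧ Cube165 a da 1 B C' M α₀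

/-- THE CENSUS, ASSEMBLED (top rung, real slice).  Hypotheses: (1.80) for the plaquette (`h180`); the (1.17)[I]-shape
for every local minimizer with data within the sup of (1.80) (`h117`, `hD`); the Prop. 6 [14]-shape for the cube with
the same data in rung units (`h1136`, `hDc`); signs.  Rows: R1 `(2 + C·B₃B₅M⁵)ε_k ≤ 3·lfFactor·α_{0,k}`, R2 `2B₃K(2 +
C·B₃B₅M⁵)ε_k ≤ 3·lfFactor·α_{0,k}`, R3 `Bg(2 + C·B₃B₅M⁵)ε_k ≤ B·α_{0,k}`.  Conclusion: membership. [folklore] -/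
theorem memberTopReal_of_rows {d₁ a da εk η B₃ B₅ M δ dist C β α₀ K Bg B C' Dc : ℝ} {d₂ D : ℕ → ℝ} {h j k : ℕ}
    (h180 : Ineq180 d₁ εk η B₃ B₅ M δ dist C) (hX : 0 ≤ C * B₃ * B₅ * M ^ 5) (hε : 0 ≤ εk) (hδ : 0 ≤ δ * dist)
    (hK : 0 ≤ 2 * B₃ * K) (h117 : ∀ p, 1 ≤ p → p ≤ k → Shape117 (d₂ p) B₃ K (D p))
    (hD : ∀ p, 1 ≤ p → p ≤ k → D p ≤ (2 + C * B₃ * B₅ * M ^ 5) * εk * η ^ 2)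
    (h1136 : Shape1136 a da Bg (C' * M) Dc) (hCM : 0 ≤ C' * M) (hBg : 0 ≤ Bg) (hDc0 : 0 ≤ Dc)
    (hDc : Dc ≤ (2 + C * B₃ * B₅ * M ^ 5) * εk)
    (hR1 : (2 + C * B₃ * B₅ * M ^ 5) * εk ≤ 3 * lfFactor β h j k k * α₀)
    (hR2 : 2 * B₃ * K * ((2 + C * B₃ * B₅ * M ^ 5) * εk) ≤ 3 * lfFactor β h j k k * α₀)
    (hR3 : Bg * ((2 + C * B₃ * B₅ * M ^ 5) * εk) ≤ B * α₀) :
    MemberTopReal d₁ d₂ a da β h j k B C' M α₀ η := by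
  refine ⟨clause168_top_of_180 h180 hX hε hδ hR1, fun p hp hpk => ?_, ?_⟩
  · exact clause168_top_entry2 (h117 p hp hpk) hK (hD p hp hpk) hR2
  · have hrow : Bg * Dc ≤ B * α₀ := le_trans (mul_le_mul_of_nonneg_left hDc hBg) hR3
    exact cube165_of_shape h1136 le_rfl hCM hDc0 hBg hrow

/-- The three rows from ONE comparison: if `2B₃K ≥ 1`, `Bg ≤ B·2B₃K/3…` — simplest sufficient package: `1 ≤ 2B₃K`,
`Bg ≤ B`, `lfFactor ≤ 1` and the single inequality `2B₃K(2 + C·B₃B₅M⁵)ε_k ≤ 3·lfFactor β h j k k·α_{0,k}` together with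
`3·lfFactor ≤ 3`, give R1 and R2; R3 needs in addition `(2 + C·B₃B₅M⁵)ε_k ≤ α_{0,k}`, which follows when moreover
`2B₃K ≥ 3`. [folklore] -/
theorem rows_of_binding {B₃ K Bg B X εk β α₀ : ℝ} {h j k : ℕ} (hβ0 : 0 ≤ β) (hK3 : 3 ≤ 2 * B₃ * K)
    (hBg : 0 ≤ Bg) (hBgB : Bg ≤ B) (hXε : 0 ≤ X * εk) (hα : 0 ≤ α₀)
    (hR2 : 2 * B₃ * K * (X * εk) ≤ 3 * lfFactor β h j k k * α₀) :
    X * εk ≤ 3 * lfFactor β h j k k * α₀ ∧ Bg * (X * εk) ≤ B * α₀ := by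
  have hF := lfFactor_le_one hβ0 h j k k
  have h1 : X * εk ≤ 3 * lfFactor β h j k k * α₀ := rowR1_of_rowR2 (by linarith) hXε hR2
  have h3F : 3 * lfFactor β h j k k * α₀ ≤ 3 * α₀ := by nlinarith
  have h2 : X * εk ≤ α₀ := by nlinarith
  exact ⟨h1, rowR3_of_le hBg hBgB hXε h2⟩

/-- ROW R2 AT ALL COUPLINGS under the reading `ε_k = g_kA₀x^{p₀}` ((2.4) [III]) and `α_{0,k} = g_kC₀x^{q₀}` ((2.28)
[III]), `x = log g_k^{−2} ≥ 1`: sufficient are `p₀ ≤ q₀` and `2B₃K(2 + C·B₃B₅M⁵)A₀ ≤ 3(1−β)C₀` (*"C₀ … sufficiently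
large"* — large compared with `B₃²B₅M⁵`), by `B14Radii.fits_of_exponents` and the floor `lfFactor_top_ge`
(`β ≥ 0`, `j < k`, `g_k ≥ 0`). [folklore] -/
theorem rowR2_of_exponents {B₃ K X A₀ C₀ g x β : ℝ} {p₀ q₀ : ℕ} {h j k : ℕ} (hβ0 : 0 ≤ β) (hhj : h ≤ j)
    (hjk : j + 1 ≤ k) (hc : 0 ≤ 2 * B₃ * K * X) (hA : 0 ≤ A₀) (hC0 : 0 ≤ C₀) (hg : 0 ≤ g) (hx : 1 ≤ x)
    (hpq : p₀ ≤ q₀) (hC : 2 * B₃ * K * X * A₀ ≤ 3 * (1 - β) * C₀) :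
    2 * B₃ * K * (X * (g * A₀ * x ^ p₀)) ≤ 3 * lfFactor β h j k k * (g * C₀ * x ^ q₀) := by
  have h1 : 2 * B₃ * K * X * (g * A₀ * x ^ p₀) ≤ 3 * (1 - β) * (g * C₀ * x ^ q₀) :=
    B14Radii.fits_of_exponents hc hA hg hx hpq hC
  have hF := lfFactor_top_ge hβ0 hhj hjk
  have hα : 0 ≤ g * C₀ * x ^ q₀ := by
    have : 0 ≤ x := le_trans zero_le_one hx
    positivity
  have h2 : 3 * (1 - β) * (g * C₀ * x ^ q₀) ≤ 3 * lfFactor β h j k k * (g * C₀ * x ^ q₀) := by nlinarith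
  calc 2 * B₃ * K * (X * (g * A₀ * x ^ p₀)) = 2 * B₃ * K * X * (g * A₀ * x ^ p₀) := by ring
    _ ≤ 3 * (1 - β) * (g * C₀ * x ^ q₀) := h1
    _ ≤ 3 * lfFactor β h j k k * (g * C₀ * x ^ q₀) := h2

/-- … and NECESSARY for the row to survive at arbitrarily small couplings is `p₀ ≤ q₀` (`B14Radii.exponent_necessary`,
with `κ = 3`, the largest value of `3·lfFactor`): positive constants, and for every `x ≥ X₀` some `g > 0` with
`2B₃K(2 + C·B₃B₅M⁵)·g A₀x^{p₀} ≤ 3·g C₀x^{q₀}`. [folklore] -/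
theorem rowR2_exponent_necessary {c A₀ C₀ : ℝ} {p₀ q₀ : ℕ} (hc : 0 < c) (hA : 0 < A₀) (hC : 0 < C₀) (X₀ : ℝ)
    (h : ∀ x : ℝ, X₀ ≤ x → ∃ g : ℝ, 0 < g ∧ c * (g * A₀ * x ^ p₀) ≤ 3 * (g * C₀ * x ^ q₀)) : p₀ ≤ q₀ :=
  B14Radii.exponent_necessary hc (by norm_num) hA hC X₀ h

end Assembly

/-! ## Part F (v1.2). Below the top rung, and the SHAPE-only form of the rows.
Under the reading «p ∈ Ω_kᶜ (∩ Z)» of (1.80)'s printed domain (header (r1′), READING C) the estimate bounds `U₀` on the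
lines of the definition BELOW the top rung that meet `Z`: the rungs `j+1 ≤ m < k` of (1.68)(iii) (`c = 1`, no `L₀`,
unit `α_{0,m}η²(L^mη)^{−2} = α_{0,m}L^{2(k−m)}η²`) and the `L₀`-weighted lines (1.64)(i) ∕ (1.66)(ii).  This part
types their ROWS (entries 1 = 5 and 2), the DOMINANCE of those rows by the top-rung row R1, the reduction of the
weighted lines to the unweighted clause, and the source-free ("shape-only") form of Part B — the rows consume only a
datum `d < (2 + C·B₃B₅M⁵)ε_kη²`, whichever printed or repaired statement supplies it (header (r1′), (r3)). -/

section BelowTop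

open ComplexSpaces (W164 W166 Clause166 one_le_W164 one_le_W166 sum_half_pow_succ_eq)

/-- The factor in closed form on every rung `m ≥ j` (all `i ≤ j ≤ m` in the first printed sum, so `|m − i| = m − i`;
`h ≤ j`): `lfFactor β h j m k = 1 − 2β·2^{−(m−j)} + 2β·2^{−(m−h)} − β + β·2^{−(k−m)}`; at `m = k` this is
`lfFactor_top`.  No closed form is recorded here for the rungs `m ≤ j − 1` of (1.64)(i), where the first printed sum has
indices `i` on both sides of `m`; on those lines Part F carries the radius only through the hypothesis `hαG` of
`clause164_of_bound` (cross-read C-adv3-87 P2). [cite: Balaban1989LargeFieldI, (1.68) p.191] -/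
theorem lfFactor_rung (β : ℝ) {h j m : ℕ} (hhj : h ≤ j) (hjm : j ≤ m) (k : ℕ) :
    lfFactor β h j m k = 1 - 2 * β * (1 / 2 : ℝ) ^ (m - j) + 2 * β * (1 / 2 : ℝ) ^ (m - h)
      - β + β * (1 / 2 : ℝ) ^ (k - m) := by
  unfold lfFactor
  have hterm : ∀ n ∈ Finset.range (j - h),
      (1 / 2 : ℝ) ^ Int.natAbs ((m : ℤ) - (h + 1 + n : ℕ)) = (1 / 2 : ℝ) ^ (m - j) * (1 / 2 : ℝ) ^ (j - h - 1 - n) := by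
    intro n hn
    rw [Finset.mem_range] at hn
    have e : Int.natAbs ((m : ℤ) - (h + 1 + n : ℕ)) = (m - j) + (j - h - 1 - n) := by omega
    rw [e, pow_add]
  have hsum1 : ∑ n ∈ Finset.range (j - h), (1 / 2 : ℝ) ^ Int.natAbs ((m : ℤ) - (h + 1 + n : ℕ))
      = (1 / 2 : ℝ) ^ (m - j) * (2 - 2 * (1 / 2 : ℝ) ^ (j - h)) := by
    rw [Finset.sum_congr rfl hterm, ← Finset.mul_sum]
    congr 1
    rw [Finset.sum_range_reflect (fun t => (1 / 2 : ℝ) ^ t) (j - h)]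
    exact sum_half_pow_eq (j - h)
  rw [hsum1, sum_half_pow_succ_eq]
  have hmh : (1 / 2 : ℝ) ^ (m - h) = (1 / 2 : ℝ) ^ (m - j) * (1 / 2 : ℝ) ^ (j - h) := by
    rw [← pow_add]; congr 1; omega
  rw [hmh]; ring

/-- Hence on the rungs of (1.68)(iii) below the top (`j + 1 ≤ m`, `β ≥ 0`): `1 − 2β ≤ lfFactor β h j m k` (and `≤ 1`,
`ComplexSpaces.lfFactor_le_one`) — at least `1/2` under the printed `β ≤ 1/4`. [folklore] -/
theorem lfFactor_rung_ge {β : ℝ} (hβ : 0 ≤ β) {h j m : ℕ} (hhj : h ≤ j) (hjm : j + 1 ≤ m) (k : ℕ) :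
    1 - 2 * β ≤ lfFactor β h j m k := by
  rw [lfFactor_rung β hhj (by omega) k]
  have hx : (1 / 2 : ℝ) ^ (m - j) ≤ 1 / 2 := by
    calc (1 / 2 : ℝ) ^ (m - j) ≤ (1 / 2 : ℝ) ^ 1 := pow_le_pow_of_le_one (by norm_num) (by norm_num) (by omega)
      _ = 1 / 2 := by norm_num
  have hy : 0 ≤ (1 / 2 : ℝ) ^ (m - h) := by positivity
  have hz : 0 ≤ (1 / 2 : ℝ) ^ (k - m) := by positivity
  nlinarith

/-- The units of the first two entries at a rung `m ≤ k`: with `η = L^{−k}` (`L ≠ 0`), `η²(L^mη)^{−2} =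
L^{−2p}(L^mL^{−p})^{−2} = L^{2(k−m)}·η²` — below the top rung the unit carries the GAIN `G = L^{2(k−m)} ≥ L²`
(at `m = k` this is `unit_entry2_top`, `G = 1`). [cite: Balaban1989LargeFieldI, (1.68) p.191] -/
theorem unit_entry12_rung {L : ℝ} (hL : L ≠ 0) (p : ℕ) {m k : ℕ} (hmk : m ≤ k) :
    ((L ^ k)⁻¹) ^ 2 * ((L ^ m * (L ^ k)⁻¹) ^ 2)⁻¹ = (L ^ (k - m)) ^ 2 * ((L ^ k)⁻¹) ^ 2 ∧
      (L ^ p)⁻¹ ^ 2 * ((L ^ m * (L ^ p)⁻¹) ^ 2)⁻¹ = (L ^ (k - m)) ^ 2 * ((L ^ k)⁻¹) ^ 2 := by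
  have hm : L ^ m ≠ 0 := pow_ne_zero _ hL
  have hk : L ^ k ≠ 0 := pow_ne_zero _ hL
  have hp : L ^ p ≠ 0 := pow_ne_zero _ hL
  have e : L ^ k = L ^ m * L ^ (k - m) := by rw [← pow_add]; congr 1; omega
  constructor
  · rw [e]; field_simp
  · rw [e]; field_simp

/-- Part B in SHAPE-only form (reading-neutral (r3)): the top-rung clause consumes only a bound of the shape
`d < (2 + X)ε_kη²` at the plaquette (`X = C·B₃B₅M⁵` for (1.80): `bound180_uniform`; any other source of the shape
serves equally) and row R1 `(2 + X)ε_k ≤ 3·lfFactor β h j k k·α_{0,k}`. [folklore] -/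
theorem clause168_top_of_bound {d X εk η β α₀ : ℝ} {h j k : ℕ} (hd : d < (2 + X) * εk * η ^ 2)
    (hrow : (2 + X) * εk ≤ 3 * lfFactor β h j k k * α₀) :
    Clause168 d β h j k k (cConst k k) (α₀ * η ^ 2) := by
  unfold Clause168 Clause164
  rw [cConst_top]
  have h2 : (2 + X) * εk * η ^ 2 ≤ 3 * lfFactor β h j k k * α₀ * η ^ 2 :=
    mul_le_mul_of_nonneg_right hrow (sq_nonneg η)
  calc d < (2 + X) * εk * η ^ 2 := hd
    _ ≤ 3 * lfFactor β h j k k * α₀ * η ^ 2 := h2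
    _ = lfFactor β h j k k * 3 * (α₀ * η ^ 2) := by ring

/-- The shape of the cell's candidate top-rung source under READING C — (H*) *"|U₀(∂p) − 1| < 2B₃B₅M⁵ε_kη² for every
p ⊂ Z"* (unit adv7, GAPS G-adv7-24: PROPOSED from Proposition 1 (1.78) and Theorem 1 [15] at one scale; NOT imported,
NOT asserted — here only the hypothesis shape `d < 2Y·ε_kη²`, `Y = B₃B₅M⁵`) — lies inside the uniform shape of (1.80)
as soon as `C ≥ 2` (`Y, ε_k ≥ 0`): `2Y ≤ 2 + C·Y`. [folklore] -/
theorem hstarShape_within_uniform {d Y C εk η : ℝ} (hC : 2 ≤ C) (hY : 0 ≤ Y) (hε : 0 ≤ εk)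
    (hd : d < 2 * Y * εk * η ^ 2) : d < (2 + C * Y) * εk * η ^ 2 := by
  have h1 : 2 * Y ≤ 2 + C * Y := by nlinarith
  have h2 : 2 * Y * εk * η ^ 2 ≤ (2 + C * Y) * εk * η ^ 2 := by
    apply mul_le_mul_of_nonneg_right _ (sq_nonneg η)
    exact mul_le_mul_of_nonneg_right h1 hε
  linarith

/-- … so under READING C the top-rung plaquette clause follows from an (H*)-shaped datum and the SAME row R1 as in
Part B (`C ≥ 2`, `B₃B₅M⁵ ≥ 0`, `ε_k ≥ 0`). [folklore] -/
theorem clause168_top_of_hstar {d B₃ B₅ M C εk η β α₀ : ℝ} {h j k : ℕ} (hC : 2 ≤ C) (hY : 0 ≤ B₃ * B₅ * M ^ 5)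
    (hε : 0 ≤ εk) (hd : d < 2 * B₃ * B₅ * M ^ 5 * εk * η ^ 2)
    (hrow : (2 + C * B₃ * B₅ * M ^ 5) * εk ≤ 3 * lfFactor β h j k k * α₀) :
    Clause168 d β h j k k (cConst k k) (α₀ * η ^ 2) := by
  have hd' : d < 2 * (B₃ * B₅ * M ^ 5) * εk * η ^ 2 := by
    have e : 2 * (B₃ * B₅ * M ^ 5) * εk * η ^ 2 = 2 * B₃ * B₅ * M ^ 5 * εk * η ^ 2 := by ring
    rw [e]; exact hd
  have h1 := hstarShape_within_uniform hC hY hε hd'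
  have e2 : (2 + C * (B₃ * B₅ * M ^ 5)) * εk * η ^ 2 = (2 + C * B₃ * B₅ * M ^ 5) * εk * η ^ 2 := by ring
  rw [e2] at h1
  exact clause168_top_of_bound h1 hrow

/-- ROW R1 BELOW THE TOP (entries `|∂𝕌 − 1| = |∂U − 1|` at a rung `m < k` of (1.68)(iii): `c = 1` (`cConst_below`),
no `L₀`, unit `α_{0,m}·G·η²` with the gain `G = L^{2(k−m)}` of `unit_entry12_rung`): a plaquette within a bound of
the shape of (1.80) meets the rung-`m` line as soon as `(2 + X)ε_k ≤ lfFactor β h j m k·α_{0,m}G`.  Under READING C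
these are lines (1.80) feeds (`(Ω_m∖Ω_{m+1}) ∩ X ⊂ Ω_kᶜ` for `m < k`). [folklore] -/
theorem clause168_rung_of_bound {d X εk η β α₀m G : ℝ} {h j m k : ℕ} (hmk : m < k)
    (hd : d < (2 + X) * εk * η ^ 2) (hrow : (2 + X) * εk ≤ lfFactor β h j m k * (α₀m * G)) :
    Clause168 d β h j m k (cConst m k) (α₀m * G * η ^ 2) := by
  unfold Clause168 Clause164
  rw [cConst_below hmk]
  have h2 : (2 + X) * εk * η ^ 2 ≤ lfFactor β h j m k * (α₀m * G) * η ^ 2 :=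
    mul_le_mul_of_nonneg_right hrow (sq_nonneg η)
  calc d < (2 + X) * εk * η ^ 2 := hd
    _ ≤ lfFactor β h j m k * (α₀m * G) * η ^ 2 := h2
    _ = lfFactor β h j m k * 1 * (α₀m * G * η ^ 2) := by ring

/-- … in particular for a plaquette obeying (1.80) (`bound180_uniform`; `C·B₃B₅M⁵, ε_k, δ·dist ≥ 0`). [folklore] -/
theorem clause168_rung_of_180 {d εk η B₃ B₅ M δ dist C β α₀m G : ℝ} {h j m k : ℕ} (hmk : m < k)
    (h180 : Ineq180 d εk η B₃ B₅ M δ dist C) (hX : 0 ≤ C * B₃ * B₅ * M ^ 5) (hε : 0 ≤ εk) (hδ : 0 ≤ δ * dist)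
    (hrow : (2 + C * B₃ * B₅ * M ^ 5) * εk ≤ lfFactor β h j m k * (α₀m * G)) :
    Clause168 d β h j m k (cConst m k) (α₀m * G * η ^ 2) :=
  clause168_rung_of_bound hmk (bound180_uniform h180 hX hε hδ) hrow

/-- ROW R2 BELOW THE TOP (entry `|∂U_{p,X}(M˙U₀) − 1|`, the (1.17)[I]-shape of Part C with data `D` within the shape
of (1.80)): the rung-`m` line (`m < k`, `c = 1`) holds as soon as `2B₃K·(2 + X)ε_k ≤ lfFactor β h j m k·α_{0,m}G`
(`2B₃K ≥ 0`). [folklore] -/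
theorem clause168_rung_entry2 {d₂ B₃ K D X εk η β α₀m G : ℝ} {h j m k : ℕ} (hmk : m < k)
    (h117 : Shape117 d₂ B₃ K D) (hK : 0 ≤ 2 * B₃ * K) (hD : D ≤ (2 + X) * εk * η ^ 2)
    (hrow : 2 * B₃ * K * ((2 + X) * εk) ≤ lfFactor β h j m k * (α₀m * G)) :
    Clause168 d₂ β h j m k (cConst m k) (α₀m * G * η ^ 2) := by
  unfold Shape117 at h117
  unfold Clause168 Clause164
  rw [cConst_below hmk]
  have h1 : 2 * B₃ * K * D ≤ 2 * B₃ * K * ((2 + X) * εk * η ^ 2) := mul_le_mul_of_nonneg_left hD hK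
  have h2 : 2 * B₃ * K * ((2 + X) * εk) * η ^ 2 ≤ lfFactor β h j m k * (α₀m * G) * η ^ 2 :=
    mul_le_mul_of_nonneg_right hrow (sq_nonneg η)
  calc d₂ < 2 * B₃ * K * D := h117
    _ ≤ 2 * B₃ * K * ((2 + X) * εk * η ^ 2) := h1
    _ = 2 * B₃ * K * ((2 + X) * εk) * η ^ 2 := by ring
    _ ≤ lfFactor β h j m k * (α₀m * G) * η ^ 2 := h2
    _ = lfFactor β h j m k * 1 * (α₀m * G * η ^ 2) := by ring

/-- DOMINANCE BY THE TOP RUNG: a top-rung row `X·ε_k ≤ 3·lfFactor β h j k k·α_{0,k}` (R1 with `X = 2 + C·B₃B₅M⁵`,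
R2 with `X = 2B₃K(2 + C·B₃B₅M⁵)`) implies the corresponding rung-`m` row (`j + 1 ≤ m`, `β ≥ 0`, `α_{0,k} ≥ 0`,
`α_{0,m}G ≥ 0`) under the side condition `3·α_{0,k} ≤ (1 − 2β)·α_{0,m}G` — e.g. `6α_{0,k} ≤ α_{0,m}L^{2(k−m)}` at
`β = 1/4`: the radii below the top are the larger ones and the top rung BINDS.  The side condition compares the radii
`α̃₀ = {α_{0,m}}` of consecutive rungs against the gain `L²` per rung; it is a hypothesis here (cf. NOT CERTIFIED (f)).
[folklore] -/
theorem rowRung_of_top {X εk β α₀k α₀m G : ℝ} {h j m k : ℕ} (hβ0 : 0 ≤ β) (hhj : h ≤ j) (hjm : j + 1 ≤ m)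
    (hαk : 0 ≤ α₀k) (hαm : 0 ≤ α₀m * G)
    (hR : X * εk ≤ 3 * lfFactor β h j k k * α₀k) (hdom : 3 * α₀k ≤ (1 - 2 * β) * (α₀m * G)) :
    X * εk ≤ lfFactor β h j m k * (α₀m * G) := by
  have hFk := lfFactor_le_one hβ0 h j k k
  have hFm : 1 - 2 * β ≤ lfFactor β h j m k := lfFactor_rung_ge hβ0 hhj hjm k
  have h1 : 3 * lfFactor β h j k k * α₀k ≤ 3 * α₀k := by nlinarith
  have h2 : (1 - 2 * β) * (α₀m * G) ≤ lfFactor β h j m k * (α₀m * G) := mul_le_mul_of_nonneg_right hFm hαm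
  linarith

/-- THE TOP RUNG BINDS (rows R1 ∕ R2 on every rung `j + 1 ≤ m < k` from the top-rung row and the side conditions).
[folklore] -/
theorem rungRows_of_top {X εk β α₀k : ℝ} {α G : ℕ → ℝ} {h j k : ℕ} (hβ0 : 0 ≤ β) (hhj : h ≤ j) (hαk : 0 ≤ α₀k)
    (hαm : ∀ m, j + 1 ≤ m → m < k → 0 ≤ α m * G m) (hR : X * εk ≤ 3 * lfFactor β h j k k * α₀k)
    (hdom : ∀ m, j + 1 ≤ m → m < k → 3 * α₀k ≤ (1 - 2 * β) * (α m * G m)) :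
    ∀ m, j + 1 ≤ m → m < k → X * εk ≤ lfFactor β h j m k * (α m * G m) :=
  fun m hjm hmk => rowRung_of_top hβ0 hhj hjm hαk (hαm m hjm hmk) hR (hdom m hjm hmk)

/-- CONTRAST with `bare_two_fails_c_one` (which is stated at the top-rung unit, gain `G = 1`): below the top rung the
factor `c = 1` is rescued by the gain of the unit — with `β ∈ [0, 1/4]`, `j + 1 ≤ m < k`, `G ≥ 4` (`= L²` at
`m = k − 1`, `L ≥ 2`) and `0 ≤ ε_k < α_{0,m}` the bare term fits: `2ε_kη² < lfFactor β h j m k·1·α_{0,m}Gη²`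
(`η ≠ 0`).  Under READING C the bare first term of (1.80) is consumed in print only below the top rung ([IV] p. 200,
for the lines of (1.24); GAPS C-b02g24-1 (2)(iv), C-adv8-36 (i)). [folklore] -/
theorem bare_two_fits_rung {εk β α₀m G η : ℝ} {h j m k : ℕ} (hβ0 : 0 ≤ β) (hβ : β ≤ 1 / 4) (hhj : h ≤ j)
    (hjm : j + 1 ≤ m) (hmk : m < k) (hε : 0 ≤ εk) (hεα : εk < α₀m) (hG : 4 ≤ G) (hη : η ≠ 0) :
    Clause168 (2 * εk * η ^ 2) β h j m k (cConst m k) (α₀m * G * η ^ 2) := by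
  unfold Clause168 Clause164
  rw [cConst_below hmk]
  have hFm : 1 - 2 * β ≤ lfFactor β h j m k := lfFactor_rung_ge hβ0 hhj hjm k
  have hη2 : 0 < η ^ 2 := by positivity
  have hαm : 0 < α₀m := lt_of_le_of_lt hε hεα
  have h12 : (1 : ℝ) / 2 ≤ 1 - 2 * β := by linarith
  have hprod : (1 : ℝ) / 2 * 4 ≤ (1 - 2 * β) * G := mul_le_mul h12 hG (by norm_num) (by linarith)
  have hGα : 0 ≤ α₀m * G := by nlinarith
  have h1 : 2 * εk < 2 * α₀m := by linarith
  have h2 : 2 * α₀m ≤ (1 - 2 * β) * (α₀m * G) := by nlinarith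
  have h3 : (1 - 2 * β) * (α₀m * G) ≤ lfFactor β h j m k * (α₀m * G) := mul_le_mul_of_nonneg_right hFm hGα
  have h4 : 2 * εk < lfFactor β h j m k * (α₀m * G) := by linarith
  calc 2 * εk * η ^ 2 < lfFactor β h j m k * (α₀m * G) * η ^ 2 := mul_lt_mul_of_pos_right h4 hη2
    _ = lfFactor β h j m k * 1 * (α₀m * G * η ^ 2) := by ring

/-- The `L₀`-WEIGHTED lines reduce to the unweighted clause: a weight `W ≥ 1` ((1.64)(i): `W164 L₀ m k₀`;
(1.66)(ii): `W166 L₀ j m`; both `≥ 1` for `L₀ ≥ 1`, `ComplexSpaces.one_le_W164` ∕ `one_le_W166`) only ENLARGES the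
radius, provided the unweighted radius `lfFactor·E` is nonnegative. [folklore] -/
theorem clause164_of_unweighted {q β W E : ℝ} {h j m k : ℕ} (hq : Clause164 q β h j m k 1 E) (hW : 1 ≤ W)
    (hE : 0 ≤ lfFactor β h j m k * E) : Clause164 q β h j m k W E := by
  unfold Clause164 at hq ⊢
  have h1 : lfFactor β h j m k * 1 * E ≤ lfFactor β h j m k * W * E := by
    have e1 : lfFactor β h j m k * 1 * E = 1 * (lfFactor β h j m k * E) := by ring
    have e2 : lfFactor β h j m k * W * E = W * (lfFactor β h j m k * E) := by ring
    rw [e1, e2]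
    exact mul_le_mul_of_nonneg_right hW hE
  linarith

/-- Hence the entry-1 clause of a weighted line — (1.64)(i) (rung `m ≤ j`, factor `lfFactor β h j m k`, weight
`W164 L₀ m k₀`) or (1.66)(ii) (diagonal factor `lfFactor β h j j k`, weight `W166 L₀ j m`) — follows from a bound of the
shape of (1.80) and the UNWEIGHTED row `(2 + X)ε_k ≤ lfFactor·(αG)` (`αG` = the entry's unit without `η²`, with
`lfFactor·αG ≥ 0`), for any weight `W ≥ 1`. [folklore] -/
theorem clause164_of_bound {d X εk η β α G W : ℝ} {h j m k : ℕ} (hd : d < (2 + X) * εk * η ^ 2)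
    (hrow : (2 + X) * εk ≤ lfFactor β h j m k * (α * G)) (hW : 1 ≤ W)
    (hαG : 0 ≤ lfFactor β h j m k * (α * G)) : Clause164 d β h j m k W (α * G * η ^ 2) := by
  refine clause164_of_unweighted ?_ hW ?_
  · unfold Clause164
    have h2 : (2 + X) * εk * η ^ 2 ≤ lfFactor β h j m k * (α * G) * η ^ 2 :=
      mul_le_mul_of_nonneg_right hrow (sq_nonneg η)
    calc d < (2 + X) * εk * η ^ 2 := hd
      _ ≤ lfFactor β h j m k * (α * G) * η ^ 2 := h2
      _ = lfFactor β h j m k * 1 * (α * G * η ^ 2) := by ring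
  · have e : lfFactor β h j m k * (α * G * η ^ 2) = lfFactor β h j m k * (α * G) * η ^ 2 := by ring
    rw [e]; exact mul_nonneg hαG (sq_nonneg η)

/-- Line (1.64)(i) (weight `W164 L₀ m k₀ = L₀^{2max{0,m−k₀}}`, `L₀ ≥ 1`), entry 1, fed by (1.80). [folklore] -/
theorem clause164i_of_180 {d εk η B₃ B₅ M δ dist C β α₀m G L₀ : ℝ} {h j m k k₀ : ℕ}
    (h180 : Ineq180 d εk η B₃ B₅ M δ dist C) (hX : 0 ≤ C * B₃ * B₅ * M ^ 5) (hε : 0 ≤ εk) (hδ : 0 ≤ δ * dist)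
    (hL₀ : 1 ≤ L₀) (hαG : 0 ≤ lfFactor β h j m k * (α₀m * G))
    (hrow : (2 + C * B₃ * B₅ * M ^ 5) * εk ≤ lfFactor β h j m k * (α₀m * G)) :
    Clause164 d β h j m k (W164 L₀ m k₀) (α₀m * G * η ^ 2) :=
  clause164_of_bound (bound180_uniform h180 hX hε hδ) hrow (one_le_W164 hL₀ m k₀) hαG

/-- Line (1.66)(ii) (diagonal factor, weight `W166 L₀ j m = L₀^{2(j−m)}`, `L₀ ≥ 1`, unit at scale `j`:
`α_{0,j}η²(L^jη)^{−2} = α_{0,j}L^{2(k−j)}η²`), entry 1, fed by (1.80). [folklore] -/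
theorem clause166_of_180 {d εk η B₃ B₅ M δ dist C β α₀j G L₀ : ℝ} {h j m k : ℕ}
    (h180 : Ineq180 d εk η B₃ B₅ M δ dist C) (hX : 0 ≤ C * B₃ * B₅ * M ^ 5) (hε : 0 ≤ εk) (hδ : 0 ≤ δ * dist)
    (hL₀ : 1 ≤ L₀) (hαG : 0 ≤ lfFactor β h j j k * (α₀j * G))
    (hrow : (2 + C * B₃ * B₅ * M ^ 5) * εk ≤ lfFactor β h j j k * (α₀j * G)) :
    Clause166 d β h j m k L₀ (α₀j * G * η ^ 2) := by
  unfold Clause166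
  exact clause164_of_bound (bound180_uniform h180 hX hε hδ) hrow (one_le_W166 hL₀ j m) hαG

end BelowTop

end Literature.MathematicalPhysics.QuantumFieldTheory.Balaban1983to89.B15.Membership195
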